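import Summits.QuantumFields.YangMills.Theorems.BalabanUVNodesN15VectorPieceLap
import Summits.QuantumFields.YangMills.Theorems.BalabanUVNodesN15VectorPieceReadout
import HarnessLib

/-!
# Route «BalabanUVNodes» (K4 «SpineRates»), node N15 = NE2, -a lane, part 23: THE FOURTH ENTRY ON THE CONCRETE CARRIER WITH A UNIFORM MAJORANT,
# AND THE UNCONDITIONAL FOUR-ENTRY READOUT — `T4EtaRate.NE2ZeroOperator` ∕ `NE2PlusOperator` BY NAME for the vector single-scale piece, NO binder left

Cell `pub-ymgap`, seat `pub-ymgap-dag-n15-a` (KNIT-BY-NAME, generation g4; HUMAN RULING D-0062; chair R424 venue; `bears_on: R4∕N15`).  Filed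
`--supports stmt-QuantumFields-19351` (helper).  One plumbing def (`reLap`, the fourth-entry factor `(Δ−∂∂*)H_k` read as a real linear map) + one (`entry3`) +
theorems; imports BY NAME part 22 (`hasMaj_idef_vectorPieceLap`), part 17 (`ne2ZeroOperator_vec_of_entry3`, `ne2PlusOperator_vec_of_entry3`, `vecInstance`,
`vecFamily`, `VecIndex`), part 15 (plumbing `kingPr`∕`kingPrV`∕`reH`∕`wTranspose`∕`covC`∕`rweight`∕`blkFine`, `card_mul_rweight`, `inv_pow_le_rpow`),
`B6UnitTorusCarrier`.  Nothing in the tree is modified; nothing printed is a hypothesis.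

THE POINT.  Part 17 landed the node-vocabulary readout of the vector single-scale piece `G = H_k·C^{(k)}·(η^{d+1}H_kᵀ)` MODULO its fourth (3.42) entry
`Δ_UG′`, taken as a displayed binder `T3`.  Parts 18–22 removed the obstruction («no printed∕tree input for second differences of `H_k`», N15-DOSSIER §6) by the
Euler–Lagrange identity `(Δ−∂∂*)H_k = n^{d+1}·Q_kᴴ·Δ_k` and the (1.66) lineage's kernel theorems.  THIS FILE closes the chain: §1 the fourth entry on the
concrete carrier `unitTorusGeo L k M` (part 14's pattern: every geometric binder discharged with equality dominances); §2 `reLap`, `entry3 :=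
𝔇(F′C′K′, FCK)` with `F = (Δ−∂∂*)H_k`, and **`hasMaj_entry3`**: a UNIFORM majorant `B·(L^k)⁻¹·e^{−ρ|y−y′|_T}` (every summand carries exactly one rate factor
`(L^k)⁻¹`, as for entry 0); §3 **`ne2ZeroOperator_vec`** ∕ **`ne2PlusOperator_vec`**: part 17's readout with `T3 := entry3` DISCHARGED — for `d + 1 ≥ 2`, `L ≥ 1`,
the realised paired-instance family of the vector piece satisfies `T4EtaRate.NE2ZeroOperator` (and the node's first conjunct `NE2PlusOperator` at the inert
one-point background), ALL FOUR (3.42) entries proved, no binder.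

HONEST FRAMING ∕ LIMITS.  `U = 1` LINEAR theory on FINITE tori (the b05∕b06 torus model), `d + 1 ≥ 2`, ONE single-scale piece in King's (4.42) shape with
Bałaban's vector factors; the Laplacian of the fourth entry is the gauge-fixed `Δ − ∂∂*` of [B5] Sect. D, NOT the covariant `Δ_U` of [B9] at `U ≠ 1`; NOT
[B6]'s multiscale expansion (NODE 00), NOT the telescoping over `j`; the [B9] size parameter `M` of the realised geometries is inert (`= 1`); the background
carrier is the one-point carrier (NE2⁺ proper NOT PRINTED ∕ not proved — the `NE2PlusOperator` conclusion carries NE2⁰ content inside NE2⁺'s type);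
count-neutral (typed 28∕28 · discharged unchanged); NOT a discharge of N15; one finite T⁴ at fixed ε — NOT infinite volume, NOT OS on ℝ⁴, NOT a mass gap, NOT Clay.
-/

noncomputable section

open scoped BigOperators
open Finset

namespace Summit.QuantumFields.YangMills.BalabanUVNodes.N15.VectorPiece

open Literature.MathematicalPhysics.QuantumFieldTheory.Balaban1983to89
open Literature.MathematicalPhysics.QuantumFieldTheory.Balaban1983to89.B11SectG (BlockNorm HasMaj)
open Literature.MathematicalPhysics.QuantumFieldTheory.Balaban1983to89.T4EtaRate (NE2PlusOperator NE2ZeroOperator)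
open Literature.MathematicalPhysics.QuantumFieldTheory.Balaban1983to89.T4EtaRateDefect (idef)
open Literature.MathematicalPhysics.QuantumFieldTheory.Balaban1983to89.T4EtaRateCoeffDefect (pull)
open Literature.MathematicalPhysics.QuantumFieldTheory.Balaban1983to89.B4TorusKernel (periodConst)
open Literature.MathematicalPhysics.QuantumFieldTheory.Balaban1983to89.B5Prop11Plancherel (Tor fine)
open Literature.MathematicalPhysics.QuantumFieldTheory.Balaban1983to89.B5Hk163Strip (kappa163 kappa163_pos)
open Literature.MathematicalPhysics.QuantumFieldTheory.Balaban1983to89.B5Hk163Decay (MG163)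
open Literature.MathematicalPhysics.QuantumFieldTheory.Balaban1983to89.B5Hk163Torus (HkOp)
open Literature.MathematicalPhysics.QuantumFieldTheory.Balaban1983to89.B5Hk163RDiv (DstarD)
open Literature.MathematicalPhysics.QuantumFieldTheory.Balaban1983to89.B5Hk163TorusHolderDecay (MD163)
open Literature.MathematicalPhysics.QuantumFieldTheory.Balaban1983to89.T4Hk163StripRate (CGe)
open Literature.MathematicalPhysics.QuantumFieldTheory.Balaban1983to89.B6LowerBound2153Torus (rep rep_mem_pbox)
open Literature.MathematicalPhysics.QuantumFieldTheory.Balaban1983to89.B6Lemma24Torus (pbox)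
open Literature.MathematicalPhysics.QuantumFieldTheory.Balaban1983to89.B6Cov2156Torus (deltaPol bondReductionT)
open Literature.MathematicalPhysics.QuantumFieldTheory.Balaban1983to89.B6UnitTorusCarrier (unitTorusGeo triangle254_unitTorusGeo
  unitTorusGeo_dist_nonneg unitTorusGeo_dist_symm rowSum_unitTorusGeo card_fibre_unitBond card_fibre_fineBond pdist_rep_rep)
open Literature.MathematicalPhysics.QuantumFieldTheory.King1986.Torus (tdistT tdistT_nonneg)

variable {d : ℕ}

/-! ## §1 The fourth entry on the concrete unit-torus carrier -/

/-- **THE FOURTH ENTRY OF THE VECTOR SINGLE-SCALE PIECE ON THE CONCRETE CARRIER** (part 22 on `unitTorusGeo L k M`, every geometric binder discharged;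
H∕F-dominance with EQUALITY at `δ = min(δ_F, κ₁₆₃∕(d+1))`, C-dominance with EQUALITY, (2.61) at `σ_r = min(δ, δ′)∕2`): `𝔇(F′C′K′, FCK)` has the displayed
explicit block majorant times `e^{−ρ|y − y′|_T}` for every `0 ≤ ρ ≤ min(δ, δ′)∕2`. [cite: Balaban1985BackgroundPropagators, (3.42) p.397 (fourth entry, shape); King1986, (4.42)–(4.43) p.675; Balaban1984PropagatorsI, (1.18) p.20, (1.63) p.28, (1.65) p.29; Balaban1984PropagatorsII, (2.156) p.250, Lemma 2.1 (2.61) p.234] -/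
theorem hasMaj_idef_vectorPieceLap_unitTorus (hd : 1 ≤ d) {L : ℕ} [NeZero L] (hL : 1 ≤ L) :
    ∃ B₀ C₁ δ' cF CF δF : ℝ, 0 < B₀ ∧ 0 < C₁ ∧ 0 < δ' ∧ 0 < cF ∧ 0 < CF ∧ 0 < δF ∧
      ∀ (M : Fin (d + 1) → ℕ) [∀ μ, NeZero (M μ)] (_ : ∀ i, L ∣ M i) (k m : ℕ) (_ : 1 ≤ m)
      (pr : Tor (fine (L ^ m * L ^ k) M) → Tor (fine (L ^ k) M)) (_ : ∀ x' μ, (pr x' μ).val = (x' μ).val / L ^ m)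
      (prV : Tor (fine (L ^ m * L ^ k) M) × Fin (d + 1) → Tor (fine (L ^ k) M) × Fin (d + 1))
      (_ : ∀ i, prV i = (pr i.1, i.2))
      (H : (Tor M × Fin (d + 1) → ℝ) →ₗ[ℝ] (Tor (fine (L ^ k) M) × Fin (d + 1) → ℝ))
      (_ : ∀ b i, H (Pi.single b 1) i = (HkOp (L ^ k) M i b).re)
      (H' : (Tor M × Fin (d + 1) → ℝ) →ₗ[ℝ] (Tor (fine (L ^ m * L ^ k) M) × Fin (d + 1) → ℝ))
      (_ : ∀ b i, H' (Pi.single b 1) i = (HkOp (L ^ m * L ^ k) M i b).re)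
      (F : (Tor M × Fin (d + 1) → ℝ) →ₗ[ℝ] (Tor (fine (L ^ k) M) × Fin (d + 1) → ℝ))
      (_ : ∀ b i, F (Pi.single b 1) i = ((DstarD (L ^ k) M * HkOp (L ^ k) M) i b).re)
      (F' : (Tor M × Fin (d + 1) → ℝ) →ₗ[ℝ] (Tor (fine (L ^ m * L ^ k) M) × Fin (d + 1) → ℝ))
      (_ : ∀ b i, F' (Pi.single b 1) i = ((DstarD (L ^ m * L ^ k) M * HkOp (L ^ m * L ^ k) M) i b).re)
      {w : ℝ} (_ : 0 ≤ w) (K : (Tor (fine (L ^ k) M) × Fin (d + 1) → ℝ) →ₗ[ℝ] (Tor M × Fin (d + 1) → ℝ))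
      (_ : ∀ i b, K (Pi.single i 1) b = w * H (Pi.single b 1) i)
      (K' : (Tor (fine (L ^ m * L ^ k) M) × Fin (d + 1) → ℝ) →ₗ[ℝ] (Tor M × Fin (d + 1) → ℝ))
      (_ : ∀ i' b, K' (Pi.single i' 1) b = w / ((L : ℝ) ^ m) ^ (d + 1) * H' (Pi.single b 1) i')
      (C : (Tor M × Fin (d + 1) → ℝ) →ₗ[ℝ] (Tor M × Fin (d + 1) → ℝ))
      (_ : ∀ b b', C (Pi.single b' 1) b =
        (bondReductionT L M (deltaPol M (L ^ k))).cov (⟨rep M b.1, rep_mem_pbox M b.1⟩, b.2) (⟨rep M b'.1, rep_mem_pbox M b'.1⟩, b'.2))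
      (C' : (Tor M × Fin (d + 1) → ℝ) →ₗ[ℝ] (Tor M × Fin (d + 1) → ℝ))
      (_ : ∀ b b', C' (Pi.single b' 1) b =
        (bondReductionT L M (deltaPol M (L ^ (k + m)))).cov (⟨rep M b.1, rep_mem_pbox M b.1⟩, b.2) (⟨rep M b'.1, rep_mem_pbox M b'.1⟩, b'.2))
      {ρ : ℝ} (_ : 0 ≤ ρ) (_ : ρ ≤ min (min δF (kappa163 (d + 1) / (d + 1))) δ' / 2),
      HasMaj (BlockNorm.ofBlocks (unitTorusGeo L k M) (blkFine L k M))
        (BlockNorm.ofBlocks (unitTorusGeo L k M) (blkFine L k M ∘ prV))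
        (idef (pull prV) (pull prV) (F' ∘ₗ (C' ∘ₗ K')) (F ∘ₗ (C ∘ₗ K)))
        (fun y y' =>
          (((d + 1 : ℕ) : ℝ) * cF * B4Sect5Proof.latticeConst (d + 1) (min (min δF (kappa163 (d + 1) / (d + 1))) δ' / 2) *
              (((d + 1 : ℕ) : ℝ) * B₀ * B4Sect5Proof.latticeConst (d + 1) (min (min δF (kappa163 (d + 1) / (d + 1))) δ' / 2) *
                  ((((d + 1) * (L ^ k) ^ (d + 1) : ℕ) : ℝ) * w * ((CGe (d + 1) + (d + 1) * MD163 (d + 1)) * periodConst (kappa163 (d + 1)) d / ((L ^ k : ℕ) : ℝ)))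
                + ((d + 1 : ℕ) : ℝ) * (C₁ * ((L : ℝ) ^ k)⁻¹) * B4Sect5Proof.latticeConst (d + 1) (min (min δF (kappa163 (d + 1) / (d + 1))) δ' / 2) *
                  ((((d + 1) * (L ^ k) ^ (d + 1) : ℕ) : ℝ) * w * (MG163 (d + 1) * periodConst (kappa163 (d + 1)) d)))
            + ((d + 1 : ℕ) : ℝ) * (CF / ((L ^ k : ℕ) : ℝ)) * B4Sect5Proof.latticeConst (d + 1) (min (min δF (kappa163 (d + 1) / (d + 1))) δ' / 2) *
              (((d + 1 : ℕ) : ℝ) * B₀ * B4Sect5Proof.latticeConst (d + 1) (min (min δF (kappa163 (d + 1) / (d + 1))) δ' / 2) *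
                ((((d + 1) * (L ^ k) ^ (d + 1) : ℕ) : ℝ) * w * (MG163 (d + 1) * periodConst (kappa163 (d + 1)) d)))) *
          Real.exp (-(ρ * tdistT M y y'))) := by
  obtain ⟨B₀, C₁, δ', cF, CF, δF, hB₀, hC₁, hδ', hcF, hCF, hδF, HP⟩ := hasMaj_idef_vectorPieceLap (d := d) hd hL
  refine ⟨B₀, C₁, δ', cF, CF, δF, hB₀, hC₁, hδ', hcF, hCF, hδF, ?_⟩
  intro M _ hLM k m hm pr hpr prV hprV H hH H' hH' F hF F' hF' w hw0 K hK K' hK' C hC C' hC' ρ hρ hρ'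
  have hδ0 : 0 < min δF (kappa163 (d + 1) / (d + 1)) := lt_min hδF (div_pos (kappa163_pos _) (by positivity))
  have hσ : 0 < min (min δF (kappa163 (d + 1) / (d + 1))) δ' / 2 := half_pos (lt_min hδ0 hδ')
  have hmin₁ : min (min δF (kappa163 (d + 1) / (d + 1))) δ' ≤ min δF (kappa163 (d + 1) / (d + 1)) := min_le_left _ _
  have hmin₂ : min (min δF (kappa163 (d + 1) / (d + 1))) δ' ≤ δ' := min_le_right _ _
  exact HP M hLM k m hm (g := unitTorusGeo L k M) (triangle254_unitTorusGeo L k M) (unitTorusGeo_dist_nonneg L k M)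
    (unitTorusGeo_dist_symm L k M) hσ.le (rowSum_unitTorusGeo L k M hσ)
    (fun b : Tor M × Fin (d + 1) => b.1) (fun y' => (card_fibre_unitBond M y').le)
    (blkFine L k M) (fun y' => (card_fibre_fineBond (L ^ k) M y').le)
    pr hpr prV hprV H hH H' hH' F hF F' hF' hw0 K hK K' hK'
    (fun b : Tor M × Fin (d + 1) => ((⟨rep M b.1, rep_mem_pbox M b.1⟩, b.2) : B4.Idx (pbox M) (d + 1))) C hC C' hC'
    (δ := min δF (kappa163 (d + 1) / (d + 1))) (fun b i => le_rfl)
    (δC := δ') (fun b b' => by rw [pdist_rep_rep])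
    hρ (by linarith) (by linarith)

/-! ## §2 The concrete fourth-entry operator and its uniform majorant -/

/-- THE FOURTH-ENTRY FACTOR `(Δ−∂∂*)H_k` (real parts of the typed matrix product `DstarD n M * HkOp n M`) as a real linear map. [cite: Balaban1984PropagatorsI, (1.63) p.28, (1.69) p.29] -/
def reLap (M : Fin (d + 1) → ℕ) [∀ μ, NeZero (M μ)] (n : ℕ) [NeZero n] :
    (Tor M × Fin (d + 1) → ℝ) →ₗ[ℝ] (Tor (fine n M) × Fin (d + 1) → ℝ) :=
  Matrix.mulVecLin ((DstarD n M * HkOp n M).map Complex.reLm)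

/-- Entries of `reLap`. [folklore] -/
theorem reLap_single (M : Fin (d + 1) → ℕ) [∀ μ, NeZero (M μ)] (n : ℕ) [NeZero n] (b : Tor M × Fin (d + 1))
    (i : Tor (fine n M) × Fin (d + 1)) : reLap M n (Pi.single b 1) i = ((DstarD n M * HkOp n M) i b).re := by
  simp [reLap, Matrix.mulVec, dotProduct, Pi.single_apply, Matrix.map_apply]

/-- ENTRY 3 — `𝔇((Δ′−∂′∂′*)G′, (Δ−∂∂*)G)` for the piece `G = H_k·C^{(k)}·(η^{d+1}H_kᵀ)` against its `η′ = L^{−m}η` twin, through King's pairing of fine bonds.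
[cite: Balaban1985BackgroundPropagators, (3.42) p.397 (fourth entry, shape); King1986, (4.42) p.675 (the piece)] -/
def entry3 (L k m : ℕ) [NeZero L] (M : Fin (d + 1) → ℕ) [∀ μ, NeZero (M μ)] :
    (Tor (fine (L ^ k) M) × Fin (d + 1) → ℝ) →ₗ[ℝ] (Tor (fine (L ^ m * L ^ k) M) × Fin (d + 1) → ℝ) :=
  idef (pull (kingPrV L k m M)) (pull (kingPrV L k m M))
    (reLap M (L ^ m * L ^ k) ∘ₗ (covC L M (L ^ (k + m)) ∘ₗ
      wTranspose M (L ^ m * L ^ k) (rweight (d := d) L k / ((L : ℝ) ^ m) ^ (d + 1)) (reH M (L ^ m * L ^ k))))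
    (reLap M (L ^ k) ∘ₗ (covC L M (L ^ k) ∘ₗ wTranspose M (L ^ k) (rweight (d := d) L k) (reH M (L ^ k))))

/-- **ENTRY 3 WITH A UNIFORM MAJORANT** (§1 at the Riemann weight `w = (L^k)^{−(d+1)}`, every constant collected — every summand carries exactly one rate factor
`(L^k)⁻¹`): `∃ B, δ₁ > 0` such that for every unit torus `Π ℤ∕M_ν` with `L ∣ M_ν`, all `k`, `m ≥ 1`, `0 ≤ ρ ≤ δ₁`: `𝔇((Δ′−∂′∂′*)G′, (Δ−∂∂*)G)` has the block
majorant `B·(L^k)⁻¹·e^{−ρ|y−y′|_T}`. [cite: Balaban1985BackgroundPropagators, (3.42) p.397 (fourth entry, shape); King1986, (4.42)–(4.43) p.675; Balaban1984PropagatorsI, (1.65) p.29; Balaban1984PropagatorsII, (2.156) p.250] -/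
theorem hasMaj_entry3 (hd : 1 ≤ d) {L : ℕ} [NeZero L] (hL : 1 ≤ L) :
    ∃ B δ₁ : ℝ, 0 < B ∧ 0 < δ₁ ∧ ∀ (M : Fin (d + 1) → ℕ) [∀ μ, NeZero (M μ)] (_ : ∀ i, L ∣ M i) (k m : ℕ) (_ : 1 ≤ m)
      {ρ : ℝ} (_ : 0 ≤ ρ) (_ : ρ ≤ δ₁),
      HasMaj (BlockNorm.ofBlocks (unitTorusGeo L k M) (blkFine L k M))
        (BlockNorm.ofBlocks (unitTorusGeo L k M) (blkFine L k M ∘ kingPrV L k m M))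
        (entry3 (d := d) L k m M) (fun y y' => B * ((L : ℝ) ^ k)⁻¹ * Real.exp (-(ρ * tdistT M y y'))) := by
  obtain ⟨B₀, C₁, δ', cF, CF, δF, hB₀, hC₁, hδ', hcF, hCF, hδF, HP⟩ := hasMaj_idef_vectorPieceLap_unitTorus (d := d) hd hL
  have hL0 : L ≠ 0 := by omega
  have hpC0 : 0 ≤ periodConst (kappa163 (d + 1)) d := (B5Kernel166Decay.periodConst_pos (kappa163_pos _) d).le
  have hMG : 0 ≤ MG163 (d + 1) := B5Hk163Decay.MG163_nonneg _
  have hδ0 : 0 < min δF (kappa163 (d + 1) / (d + 1)) := lt_min hδF (div_pos (kappa163_pos _) (by positivity))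
  have hσ : 0 < min (min δF (kappa163 (d + 1) / (d + 1))) δ' / 2 := half_pos (lt_min hδ0 hδ')
  have hcr0 : 0 ≤ B4Sect5Proof.latticeConst (d + 1) (min (min δF (kappa163 (d + 1) / (d + 1))) δ' / 2) :=
    B4Sect5Proof.latticeConst_nonneg (d + 1) hσ.le
  have hMD : 0 ≤ MD163 (d + 1) :=
    (mul_nonneg_iff_of_pos_right (B5Kernel166Decay.periodConst_pos (kappa163_pos _) d)).mp
      (B5Hk163TorusHolderDecay.CdecD_nonneg (d := d))
  have hCGe : 0 ≤ CGe (d + 1) := T4Hk163StripRate.CGe_nonneg _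
  refine ⟨((d + 1 : ℕ) : ℝ) * cF * B4Sect5Proof.latticeConst (d + 1) (min (min δF (kappa163 (d + 1) / (d + 1))) δ' / 2) *
        (((d + 1 : ℕ) : ℝ) * B₀ * B4Sect5Proof.latticeConst (d + 1) (min (min δF (kappa163 (d + 1) / (d + 1))) δ' / 2) *
            (((d + 1 : ℕ) : ℝ) * ((CGe (d + 1) + (d + 1) * MD163 (d + 1)) * periodConst (kappa163 (d + 1)) d))
          + ((d + 1 : ℕ) : ℝ) * C₁ * B4Sect5Proof.latticeConst (d + 1) (min (min δF (kappa163 (d + 1) / (d + 1))) δ' / 2) *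
            (((d + 1 : ℕ) : ℝ) * (MG163 (d + 1) * periodConst (kappa163 (d + 1)) d)))
      + ((d + 1 : ℕ) : ℝ) * CF * B4Sect5Proof.latticeConst (d + 1) (min (min δF (kappa163 (d + 1) / (d + 1))) δ' / 2) *
        (((d + 1 : ℕ) : ℝ) * B₀ * B4Sect5Proof.latticeConst (d + 1) (min (min δF (kappa163 (d + 1) / (d + 1))) δ' / 2) *
          (((d + 1 : ℕ) : ℝ) * (MG163 (d + 1) * periodConst (kappa163 (d + 1)) d))) + 1,
    min (min δF (kappa163 (d + 1) / (d + 1))) δ' / 2, by positivity, hσ, ?_⟩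
  intro M _ hLM k m hm ρ hρ hρ1
  have key := HP M hLM k m hm (kingPr L k m M) (kingPr_val L k m M) (kingPrV L k m M) (fun _ => rfl)
    (reH M (L ^ k)) (reH_single M (L ^ k)) (reH M (L ^ m * L ^ k)) (reH_single M (L ^ m * L ^ k))
    (reLap M (L ^ k)) (reLap_single M (L ^ k)) (reLap M (L ^ m * L ^ k)) (reLap_single M (L ^ m * L ^ k))
    (rweight_nonneg (d := d) L k)
    (wTranspose M (L ^ k) (rweight (d := d) L k) (reH M (L ^ k))) (wTranspose_single M (L ^ k) (rweight (d := d) L k) (reH M (L ^ k)))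
    (wTranspose M (L ^ m * L ^ k) (rweight (d := d) L k / ((L : ℝ) ^ m) ^ (d + 1)) (reH M (L ^ m * L ^ k)))
    (wTranspose_single M (L ^ m * L ^ k) (rweight (d := d) L k / ((L : ℝ) ^ m) ^ (d + 1)) (reH M (L ^ m * L ^ k)))
    (covC L M (L ^ k)) (covC_single L M (L ^ k)) (covC L M (L ^ (k + m))) (covC_single L M (L ^ (k + m))) hρ hρ1
  refine key.mono fun y y' => ?_
  have hbal := card_mul_rweight (d := d) hL0 k
  have hcast : ((L ^ k : ℕ) : ℝ) = (L : ℝ) ^ k := by push_cast; ring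
  rw [hbal, hcast]
  have hE : 0 ≤ Real.exp (-(ρ * tdistT M y y')) := Real.exp_nonneg _
  have hx : 0 < ((L : ℝ) ^ k)⁻¹ := inv_pos.mpr (pow_pos (by exact_mod_cast (show 0 < L by omega)) _)
  have heq : ∀ (E : ℝ),
      (((d + 1 : ℕ) : ℝ) * cF * B4Sect5Proof.latticeConst (d + 1) (min (min δF (kappa163 (d + 1) / (d + 1))) δ' / 2) *
          (((d + 1 : ℕ) : ℝ) * B₀ * B4Sect5Proof.latticeConst (d + 1) (min (min δF (kappa163 (d + 1) / (d + 1))) δ' / 2) *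
              (((d + 1 : ℕ) : ℝ) * ((CGe (d + 1) + (d + 1) * MD163 (d + 1)) * periodConst (kappa163 (d + 1)) d / ((L : ℝ) ^ k)))
            + ((d + 1 : ℕ) : ℝ) * (C₁ * ((L : ℝ) ^ k)⁻¹) *
                B4Sect5Proof.latticeConst (d + 1) (min (min δF (kappa163 (d + 1) / (d + 1))) δ' / 2) *
              (((d + 1 : ℕ) : ℝ) * (MG163 (d + 1) * periodConst (kappa163 (d + 1)) d)))
        + ((d + 1 : ℕ) : ℝ) * (CF / ((L : ℝ) ^ k)) *
            B4Sect5Proof.latticeConst (d + 1) (min (min δF (kappa163 (d + 1) / (d + 1))) δ' / 2) *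
          (((d + 1 : ℕ) : ℝ) * B₀ * B4Sect5Proof.latticeConst (d + 1) (min (min δF (kappa163 (d + 1) / (d + 1))) δ' / 2) *
            (((d + 1 : ℕ) : ℝ) * (MG163 (d + 1) * periodConst (kappa163 (d + 1)) d)))) * E
      = (((d + 1 : ℕ) : ℝ) * cF * B4Sect5Proof.latticeConst (d + 1) (min (min δF (kappa163 (d + 1) / (d + 1))) δ' / 2) *
        (((d + 1 : ℕ) : ℝ) * B₀ * B4Sect5Proof.latticeConst (d + 1) (min (min δF (kappa163 (d + 1) / (d + 1))) δ' / 2) *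
            (((d + 1 : ℕ) : ℝ) * ((CGe (d + 1) + (d + 1) * MD163 (d + 1)) * periodConst (kappa163 (d + 1)) d))
          + ((d + 1 : ℕ) : ℝ) * C₁ * B4Sect5Proof.latticeConst (d + 1) (min (min δF (kappa163 (d + 1) / (d + 1))) δ' / 2) *
            (((d + 1 : ℕ) : ℝ) * (MG163 (d + 1) * periodConst (kappa163 (d + 1)) d)))
      + ((d + 1 : ℕ) : ℝ) * CF * B4Sect5Proof.latticeConst (d + 1) (min (min δF (kappa163 (d + 1) / (d + 1))) δ' / 2) *
        (((d + 1 : ℕ) : ℝ) * B₀ * B4Sect5Proof.latticeConst (d + 1) (min (min δF (kappa163 (d + 1) / (d + 1))) δ' / 2) *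
          (((d + 1 : ℕ) : ℝ) * (MG163 (d + 1) * periodConst (kappa163 (d + 1)) d)))) * ((L : ℝ) ^ k)⁻¹ * E := by
    intro E; field_simp
  rw [heq]
  exact mul_le_mul_of_nonneg_right (mul_le_mul_of_nonneg_right (le_add_of_nonneg_right zero_le_one) hx.le) hE

/-! ## §3 THE UNCONDITIONAL FOUR-ENTRY READOUT -/

/-- **NE2⁰, OPERATOR LAYER, FOR THE VECTOR SINGLE-SCALE PIECE — ALL FOUR (3.42) ENTRIES, NO BINDER.**  For `d + 1 ≥ 2`, `L ≥ 1`, the realised paired-instance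
family of the piece (part 17 `vecInstance`) with the kernel families of the four concrete entry operators `![entry0, entry1 ν, entry2 ν, entry3]` satisfies
`T4EtaRate.NE2ZeroOperator` BY NAME: part 17's `ne2ZeroOperator_vec_of_entry3` with its binder `T3 := entry3` DISCHARGED by `hasMaj_entry3` (rate exponent
`γ₃ = 1`). [cite: Balaban1985BackgroundPropagators, Thm 3.1 (3.42) p.397 (shape); King1986, Props. 3.8–3.9 (3.71)–(3.75) pp.664–665 (A = 0 model)] -/
theorem ne2ZeroOperator_vec (hd : 1 ≤ d) {L : ℕ} [NeZero L] (hL : 1 ≤ L) :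
    NE2ZeroOperator (vecInstance (d := d) hL) (vecFamily hL fun i : VecIndex d L => entry3 (d := d) L i.k i.m i.Mn) := by
  obtain ⟨B, δ₁, hB, hδ₁, H3⟩ := hasMaj_entry3 (d := d) hd hL
  refine ne2ZeroOperator_vec_of_entry3 hd hL (fun i : VecIndex d L => entry3 (d := d) L i.k i.m i.Mn) (B₃ := B) (γ₃ := 1) (δ₃ := δ₁) one_pos hδ₁
    fun i => ?_
  refine (H3 i.Mn i.dvd i.k i.m i.one_le hδ₁.le le_rfl).mono fun y y' => le_of_eq ?_
  rw [Real.rpow_neg_one]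

/-- **NE2⁺, OPERATOR LAYER — THE NODE'S FIRST CONJUNCT `T4EtaRate.NE2PlusOperator` BY NAME FOR THE VECTOR PIECE, ALL FOUR ENTRIES, NO BINDER** (at the
one-point background carrier: the «+» block is inert there and the content is NE2⁰'s — said). [cite: Balaban1985BackgroundPropagators, Thm 3.1 p.397 (quantifier template)] -/
theorem ne2PlusOperator_vec (hd : 1 ≤ d) {L : ℕ} [NeZero L] (hL : 1 ≤ L) (c35 : ℝ) :
    NE2PlusOperator c35 (vecInstance (d := d) hL) (vecFamily hL fun i : VecIndex d L => entry3 (d := d) L i.k i.m i.Mn) := by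
  obtain ⟨B, δ₁, hB, hδ₁, H3⟩ := hasMaj_entry3 (d := d) hd hL
  refine ne2PlusOperator_vec_of_entry3 hd hL c35 (fun i : VecIndex d L => entry3 (d := d) L i.k i.m i.Mn) (B₃ := B) (γ₃ := 1) (δ₃ := δ₁) one_pos hδ₁
    fun i => ?_
  refine (H3 i.Mn i.dvd i.k i.m i.one_le hδ₁.le le_rfl).mono fun y y' => le_of_eq ?_
  rw [Real.rpow_neg_one]

/-- The four-dimensional instance (`d + 1 = 4`): the U = 1 vector single-scale piece on the four-dimensional unit tori satisfies the NE2⁰ operator layer with all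
four (3.42) entries, for every block factor `L ≥ 1`. [cite: Balaban1985BackgroundPropagators, Thm 3.1 (3.42) p.397 (shape)] -/
theorem ne2ZeroOperator_vec_dim4 {L : ℕ} [NeZero L] (hL : 1 ≤ L) :
    NE2ZeroOperator (vecInstance (d := 3) hL) (vecFamily hL fun i : VecIndex 3 L => entry3 (d := 3) L i.k i.m i.Mn) :=
  ne2ZeroOperator_vec (d := 3) (by norm_num) hL

end Summit.QuantumFields.YangMills.BalabanUVNodes.N15.VectorPiece
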